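import Literature.Analysis.FunctionSpaces.TorusTrilinearH1
import Literature.Analysis.FunctionSpaces.TorusEnstrophyTrilinear
import HarnessLib

/-!
# Trilinear flux bounds for the `V`-stability of strong solutions on `T³`

Analysis/FunctionSpaces support file (everything proved; no definitions, no named facts), sequel of
`TorusTrilinearH1.lean` (`|∫ ⟪u, (z·∇)a⟫| ≤ C ‖∇u‖₂‖∇z‖₂‖∇a‖₂` for zero-mean fields on `T³`) and
`TorusEnstrophyTrilinear.lean` (`∫ |∇u|⁴ ≤ K ‖∇u‖₂ ‖Δu‖₂³`). It supplies the three pointwise-in-time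
bounds of the first-order terms of the difference equation `∂ₜw = νΔw − (u₁·∇)w − (w·∇)u₂ − ∇q`
of two strong solutions that use ONLY the enstrophies `‖∇u₁‖₂, ‖∇u₂‖₂` and the (square integrable
in time) `‖Δu₂‖₂` of the two solutions — the coefficients of the `V`-continuous-dependence /
uniqueness argument for strong solutions in three dimensions (Constantin–Foias 1988, Ch. 10,
Thm. 10.2 with (10.7) and Remark 10.3: `d/dt |w|² ≤ (c/ν) ‖u₂‖ |Au₂| |w|²`, Grönwall with the
integrable coefficient; the trilinear inequalities are instances of Prop. 6.1, (6.9)):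

* `Torus.le_mul_add_mul_of_pow_succ_le` — the real-variable absorption step
  `T^{n+1} ≤ K G Lⁿ ⟹ T ≤ εL + K ε⁻ⁿ G` (`ε > 0`), i.e. Young's inequality in polynomial form;
* `Torus.integral_norm_fderiv_pow_four_le` (+ `…_sq_le`, `…_le_mul_add_sq`) — `∫ ‖Dw‖⁴ ≤
  K ‖∇w‖₂ ‖Δw‖₂³` for every smooth `w : T³ → ℝ³` (operator norm of the full derivative; from
  `Torus.integral_sum_norm_sq_partialDeriv_sq_le`), with the polynomial consequences
  `(∫ ‖Dw‖⁴)² ≤ K ‖∇w‖₂² (‖Δw‖₂²)³` and `∫ ‖Dw‖⁴ ≤ K (‖∇w‖₂² + ‖Δw‖₂²)²`;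
* `Torus.abs_integral_inner_convect_self_le_gradNormSq` — `|∫ ⟪(w·∇)v, w⟫| ≤ C ‖∇w‖₂² ‖∇v‖₂`
  for zero-mean `w` (the energy flux of the difference; `TorusTrilinearH1`);
* `Torus.abs_integral_inner_convect_laplacian_transport_le` — **transport term against the
  Laplacian**: `|∫ ⟪(u·∇)w, Δw⟫| ≤ ε ‖Δw‖₂² + K ε⁻⁷ (‖∇u‖₂²)⁴ ‖∇w‖₂²` for zero-mean `u`
  (Hölder `L⁴ · L⁴ · L²`, `‖u‖_{L⁴} ≤ c‖∇u‖₂`, `‖Dw‖_{L⁴} ≤ c ‖∇w‖₂^{1/4} ‖Δw‖₂^{3/4}`, Young with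
  exponents `(8, 8/7)`);
* `Torus.abs_integral_inner_convect_laplacian_stretching_le` — **stretching term against the
  Laplacian**: `|∫ ⟪(w·∇)v, Δw⟫| ≤ ε ‖Δw‖₂² + K ε⁻¹ (‖∇v‖₂² + ‖Δv‖₂²) ‖∇w‖₂²` for zero-mean `w`
  (Hölder `L⁴ · L⁴ · L²`, `‖w‖_{L⁴} ≤ c‖∇w‖₂`, `‖Dv‖_{L⁴}² ≤ c (‖∇v‖₂² + ‖Δv‖₂²)`).

Constants are existential (they come from Mathlib's Gagliardo–Nirenberg–Sobolev constant through
`TorusSobolevL6`); only their independence of `ε`, `u`, `v`, `w` matters downstream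
(`TorusClassicalNSVStability.lean`).

## Mathlib / tree search

Tree (reused): `Torus.abs_integral_inner_convect_le_of_hasZeroMean`,
`Torus.integral_norm_pow_four_le_gradNormSq_sq`, `Torus.integral_mul_le_sqrt_mul_sqrt_of_continuous`,
`Torus.continuous_fderiv_of_isSmooth` (`TorusTrilinearH1`), `Torus.integral_sum_norm_sq_partialDeriv_sq_le`
(`TorusEnstrophyTrilinear`), `Torus.norm_fderiv_sq_le_card_mul_sum` (`LadyzhenskayaTorus`); the
existing Laplacian pairings are `Torus.abs_integral_inner_convect_laplacian_le(_dissipation)`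
(`b(u, u, Δu)`, one field) and the sup-norm coefficient bounds of
`TorusClassicalNSDifferenceBalances` / `FluidPDE/TorusLinearisedNSH1Balance`; searched
`convect.*laplacian.*le`, `transport`, `stretching`, `pow_four.*fderiv`: no two-field `H¹ × H²`
pairing bounds. Mathlib: `ContinuousLinearMap.le_opNorm`, `Real.rpow_le_rpow`, `Real.rpow_add'`.

## References

* P. Constantin, C. Foias, *Navier–Stokes Equations*, Univ. Chicago Press 1988, Ch. 6 Prop. 6.1
  (6.9) and Ch. 10, Thm. 10.2, (10.7), Remark 10.3. [ConstantinFoiasNSE1988]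
* C. Foias, O. Manley, R. Rosa, R. Temam, *Navier–Stokes Equations and Turbulence*, CUP 2001,
  Ch. II App. A, (A.26)–(A.27). [FoiasManleyRosaTemam2001]
-/

noncomputable section

open MeasureTheory Set Filter Function
open scoped ENNReal NNReal InnerProductSpace ContDiff

namespace Literature.Analysis.FunctionSpaces

namespace Torus

variable {d : Type*} [Fintype d] [DecidableEq d]

/-! ### Real-variable absorption (Young's inequality in polynomial form) -/

omit [Fintype d] [DecidableEq d] in
/-- **Absorption step.** If `T^{n+1} ≤ K G Lⁿ` with `K, G, L ≥ 0`, then for every `ε > 0`,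
`T ≤ ε L + K ε⁻ⁿ G`: either `T ≤ εL`, or `L < T/ε` and then `T^{n+1} ≤ K G Tⁿ ε⁻ⁿ`. This is Young's
inequality `a^{1/(n+1)} b^{n/(n+1)} ≤ …` in the polynomial form convenient for `L²`-energy estimates.
[folklore] -/
theorem le_mul_add_mul_of_pow_succ_le {T K G L ε : ℝ} {n : ℕ} (hK : 0 ≤ K) (hG : 0 ≤ G)
    (hL : 0 ≤ L) (hε : 0 < ε) (h : T ^ (n + 1) ≤ K * G * L ^ n) :
    T ≤ ε * L + K * (ε ^ n)⁻¹ * G := by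
  have hR : 0 ≤ K * (ε ^ n)⁻¹ * G := by positivity
  by_cases hc : T ≤ ε * L
  · exact hc.trans (le_add_of_nonneg_right hR)
  · push Not at hc
    have hT0 : 0 < T := lt_of_le_of_lt (by positivity) hc
    have hLT : L ≤ T / ε := by
      rw [le_div_iff₀ hε]
      linarith [mul_comm ε L]
    have h1 : L ^ n ≤ (T / ε) ^ n := pow_le_pow_left₀ hL hLT n
    have h3 : T * T ^ n ≤ (K * (ε ^ n)⁻¹ * G) * T ^ n := by
      calc T * T ^ n = T ^ (n + 1) := by ring
        _ ≤ K * G * L ^ n := h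
        _ ≤ K * G * (T / ε) ^ n := mul_le_mul_of_nonneg_left h1 (by positivity)
        _ = (K * (ε ^ n)⁻¹ * G) * T ^ n := by rw [div_pow]; ring
    have h4 : T ≤ K * (ε ^ n)⁻¹ * G := le_of_mul_le_mul_right h3 (pow_pos hT0 n)
    exact h4.trans (le_add_of_nonneg_left (by positivity))

/-! ### `∫ ‖Dw‖⁴` by Ladyzhenskaya's inequality -/

/-- **`∫ ‖Dw‖⁴ ≤ K ‖∇w‖₂ ‖Δw‖₂³` on `T³`, operator-norm form.** On `T^d` with `card d = 3` there is
`K ≥ 0` such that for every smooth `w : T^d → ℝ^d`,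
`∫ ‖Dw‖⁴ ≤ K (‖∇w‖₂²)^{1/2} (‖Δw‖₂²)^{3/2}` with `Dw = Torus.fderiv w`, `‖∇w‖₂² = gradNormSq w`,
`‖Δw‖₂² = ∫ ‖Δw‖²`: `‖Dw‖² ≤ 3 ∑ₘ ‖∂ₘw‖²` pointwise (`norm_fderiv_sq_le_card_mul_sum`) and
`∫ (∑ₘ ‖∂ₘw‖²)² ≤ K' ‖∇w‖₂ ‖Δw‖₂³` (`integral_sum_norm_sq_partialDeriv_sq_le`, Ladyzhenskaya's
inequality for the zero-mean fields `∂ₘw`). [cite: FoiasManleyRosaTemam2001, Ch. II App. A (A.27)] -/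
theorem integral_norm_fderiv_pow_four_le (hd : Fintype.card d = 3) :
    ∃ K : ℝ, 0 ≤ K ∧ ∀ w : UnitAddTorus d → EuclideanSpace ℝ d, IsSmooth w →
      ∫ x, ‖Torus.fderiv w x‖ ^ 4 ≤
        K * gradNormSq w ^ (1 / 2 : ℝ) * (∫ x, ‖laplacian w x‖ ^ 2) ^ (3 / 2 : ℝ) := by
  obtain ⟨K, hK⟩ := integral_sum_norm_sq_partialDeriv_sq_le (d := d) hd
  refine ⟨9 * K, by positivity, fun w hw => ?_⟩
  have hθc : Continuous fun x => ∑ m, ‖partialDeriv m w x‖ ^ 2 :=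
    continuous_finsetSum _ fun m _ => (hw.partialDeriv m).continuous.norm.pow 2
  have hpt : ∀ x, ‖Torus.fderiv w x‖ ^ 4 ≤ 9 * (∑ m, ‖partialDeriv m w x‖ ^ 2) ^ 2 := fun x => by
    have h := norm_fderiv_sq_le_card_mul_sum (hw.isContDiff (by simp)) x
    rw [hd] at h
    push_cast at h
    calc ‖Torus.fderiv w x‖ ^ 4 = (‖Torus.fderiv w x‖ ^ 2) ^ 2 := by ring
      _ ≤ (3 * ∑ m, ‖partialDeriv m w x‖ ^ 2) ^ 2 := pow_le_pow_left₀ (sq_nonneg _) h 2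
      _ = 9 * (∑ m, ‖partialDeriv m w x‖ ^ 2) ^ 2 := by ring
  calc ∫ x, ‖Torus.fderiv w x‖ ^ 4 ≤ ∫ x, 9 * (∑ m, ‖partialDeriv m w x‖ ^ 2) ^ 2 :=
        integral_mono ((continuous_fderiv_of_isSmooth hw).norm.pow 4).integrable_unitAddTorus
          ((hθc.pow 2).integrable_unitAddTorus.const_mul _) hpt
    _ = 9 * ∫ x, (∑ m, ‖partialDeriv m w x‖ ^ 2) ^ 2 := integral_const_mul _ _
    _ ≤ 9 * (K * gradNormSq w ^ (1 / 2 : ℝ) * (∫ x, ‖laplacian w x‖ ^ 2) ^ (3 / 2 : ℝ)) :=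
        mul_le_mul_of_nonneg_left (hK w hw) (by norm_num)
    _ = 9 * K * gradNormSq w ^ (1 / 2 : ℝ) * (∫ x, ‖laplacian w x‖ ^ 2) ^ (3 / 2 : ℝ) := by ring

/-- **Polynomial form `(∫ ‖Dw‖⁴)² ≤ K ‖∇w‖₂² (‖Δw‖₂²)³`** of `integral_norm_fderiv_pow_four_le`
(square both sides). [folklore] -/
theorem integral_norm_fderiv_pow_four_sq_le (hd : Fintype.card d = 3) :
    ∃ K : ℝ, 0 ≤ K ∧ ∀ w : UnitAddTorus d → EuclideanSpace ℝ d, IsSmooth w →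
      (∫ x, ‖Torus.fderiv w x‖ ^ 4) ^ 2 ≤ K * gradNormSq w * (∫ x, ‖laplacian w x‖ ^ 2) ^ 3 := by
  obtain ⟨K, hK0, hK⟩ := integral_norm_fderiv_pow_four_le (d := d) hd
  refine ⟨K ^ 2, by positivity, fun w hw => ?_⟩
  set G : ℝ := gradNormSq w with hG
  set L : ℝ := ∫ x, ‖laplacian w x‖ ^ 2 with hL
  have hG0 : 0 ≤ G := gradNormSq_nonneg w
  have hL0 : 0 ≤ L := integral_nonneg fun x => sq_nonneg _
  have hI0 : 0 ≤ ∫ x, ‖Torus.fderiv w x‖ ^ 4 := integral_nonneg fun x => by positivity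
  have h := hK w hw
  have eG : (G ^ (1 / 2 : ℝ)) ^ 2 = G := by
    rw [← Real.rpow_natCast (G ^ (1 / 2 : ℝ)) 2, ← Real.rpow_mul hG0]
    norm_num
  have eL : (L ^ (3 / 2 : ℝ)) ^ 2 = L ^ 3 := by
    rw [← Real.rpow_natCast (L ^ (3 / 2 : ℝ)) 2, ← Real.rpow_mul hL0, ← Real.rpow_natCast L 3]
    norm_num
  calc (∫ x, ‖Torus.fderiv w x‖ ^ 4) ^ 2 ≤ (K * G ^ (1 / 2 : ℝ) * L ^ (3 / 2 : ℝ)) ^ 2 :=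
        pow_le_pow_left₀ hI0 h 2
    _ = K ^ 2 * (G ^ (1 / 2 : ℝ)) ^ 2 * (L ^ (3 / 2 : ℝ)) ^ 2 := by ring
    _ = K ^ 2 * G * L ^ 3 := by rw [eG, eL]

/-- **Polynomial form `∫ ‖Dv‖⁴ ≤ K (‖∇v‖₂² + ‖Δv‖₂²)²`** of `integral_norm_fderiv_pow_four_le`
(`G^{1/2} L^{3/2} ≤ (G + L)^{1/2} (G + L)^{3/2} = (G + L)²`). [folklore] -/
theorem integral_norm_fderiv_pow_four_le_mul_add_sq (hd : Fintype.card d = 3) :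
    ∃ K : ℝ, 0 ≤ K ∧ ∀ v : UnitAddTorus d → EuclideanSpace ℝ d, IsSmooth v →
      ∫ x, ‖Torus.fderiv v x‖ ^ 4 ≤ K * (gradNormSq v + ∫ x, ‖laplacian v x‖ ^ 2) ^ 2 := by
  obtain ⟨K, hK0, hK⟩ := integral_norm_fderiv_pow_four_le (d := d) hd
  refine ⟨K, hK0, fun v hv => ?_⟩
  set G : ℝ := gradNormSq v with hG
  set L : ℝ := ∫ x, ‖laplacian v x‖ ^ 2 with hL
  have hG0 : 0 ≤ G := gradNormSq_nonneg v
  have hL0 : 0 ≤ L := integral_nonneg fun x => sq_nonneg _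
  have hS0 : 0 ≤ G + L := add_nonneg hG0 hL0
  have h1 : G ^ (1 / 2 : ℝ) ≤ (G + L) ^ (1 / 2 : ℝ) :=
    Real.rpow_le_rpow hG0 (le_add_of_nonneg_right hL0) (by norm_num)
  have h2 : L ^ (3 / 2 : ℝ) ≤ (G + L) ^ (3 / 2 : ℝ) :=
    Real.rpow_le_rpow hL0 (le_add_of_nonneg_left hG0) (by norm_num)
  have h3 : (G + L) ^ (1 / 2 : ℝ) * (G + L) ^ (3 / 2 : ℝ) = (G + L) ^ 2 := by
    rw [← Real.rpow_add' hS0 (by norm_num), show (1 / 2 : ℝ) + 3 / 2 = 2 by norm_num, Real.rpow_two]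
  calc ∫ x, ‖Torus.fderiv v x‖ ^ 4 ≤ K * G ^ (1 / 2 : ℝ) * L ^ (3 / 2 : ℝ) := hK v hv
    _ ≤ K * (G + L) ^ (1 / 2 : ℝ) * (G + L) ^ (3 / 2 : ℝ) := by
        rw [mul_assoc, mul_assoc]
        exact mul_le_mul_of_nonneg_left
          (mul_le_mul h1 h2 (Real.rpow_nonneg hL0 _) (Real.rpow_nonneg hS0 _)) hK0
    _ = K * (G + L) ^ 2 := by rw [mul_assoc, h3]

/-! ### The three flux bounds -/

/-- **Energy flux of the difference by enstrophies**: on `T^d`, `card d = 3`, there is `C ≥ 0` with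
`|∫ ⟪(w·∇)v, w⟫| ≤ C ‖∇w‖₂² ‖∇v‖₂` for smooth `w, v : T^d → ℝ^d` with `∫ w = 0`
(`‖∇v‖₂ = √(gradNormSq v)`): Temam's trilinear bound `|b(w, v, w)| ≤ c‖w‖ ‖v‖ ‖w‖` on `V`
(`Torus.abs_integral_inner_convect_le_of_hasZeroMean` with `u = z = w`, `a = v`).
[cite: ConstantinFoiasNSE1988, Ch. 6 Prop. 6.1 (6.9)] -/
theorem abs_integral_inner_convect_self_le_gradNormSq (hd : Fintype.card d = 3) :
    ∃ C : ℝ, 0 ≤ C ∧ ∀ w v : UnitAddTorus d → EuclideanSpace ℝ d, IsSmooth w → IsSmooth v →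
      HasZeroMean w →
      |∫ x, ⟪convect w v x, w x⟫_ℝ| ≤ C * gradNormSq w * Real.sqrt (gradNormSq v) := by
  obtain ⟨C, hC0, hC⟩ := abs_integral_inner_convect_le_of_hasZeroMean (d := d) hd
  refine ⟨C, hC0, fun w v hw hv hw0 => ?_⟩
  have hcomm : ∫ x, ⟪convect w v x, w x⟫_ℝ = ∫ x, ⟪w x, convect w v x⟫_ℝ :=
    integral_congr_ae (ae_of_all _ fun x => real_inner_comm _ _)
  rw [hcomm]
  calc |∫ x, ⟪w x, convect w v x⟫_ℝ|
      ≤ C * Real.sqrt (gradNormSq w) * Real.sqrt (gradNormSq w) * Real.sqrt (gradNormSq v) :=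
        hC w w v hw hw hv hw0 hw0
    _ = C * gradNormSq w * Real.sqrt (gradNormSq v) := by
        rw [mul_assoc C, Real.mul_self_sqrt (gradNormSq_nonneg w)]

omit [DecidableEq d] in
/-- The pairing of a convective derivative against a field is controlled by Cauchy–Schwarz through
the operator norm of the full derivative: `|∫ ⟪(z·∇)a, b⟫| ≤ √(∫ ‖z‖²‖Da‖²) √(∫ ‖b‖²)`
(`(z·∇)a = Da[z]`). [folklore] -/
theorem abs_integral_inner_convect_le_sqrt_mul_sqrt {z a b : UnitAddTorus d → EuclideanSpace ℝ d}
    (hz : IsSmooth z) (ha : IsSmooth a) (hb : IsSmooth b) :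
    |∫ x, ⟪convect z a x, b x⟫_ℝ| ≤
      Real.sqrt (∫ x, (‖z x‖ * ‖Torus.fderiv a x‖) ^ 2) * Real.sqrt (∫ x, ‖b x‖ ^ 2) := by
  set P : UnitAddTorus d → ℝ := fun x => ‖z x‖ * ‖Torus.fderiv a x‖ with hP
  have hPc : Continuous P := hz.continuous.norm.mul (continuous_fderiv_of_isSmooth ha).norm
  have hQc : Continuous fun x => ‖b x‖ := hb.continuous.norm
  have hpt : ∀ x, ‖⟪convect z a x, b x⟫_ℝ‖ ≤ P x * ‖b x‖ := fun x => by
    calc ‖⟪convect z a x, b x⟫_ℝ‖ ≤ ‖convect z a x‖ * ‖b x‖ := norm_inner_le_norm _ _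
      _ ≤ (‖Torus.fderiv a x‖ * ‖z x‖) * ‖b x‖ :=
          mul_le_mul_of_nonneg_right (ContinuousLinearMap.le_opNorm _ _) (norm_nonneg _)
      _ = P x * ‖b x‖ := by simp only [hP]; ring
  calc |∫ x, ⟪convect z a x, b x⟫_ℝ| = ‖∫ x, ⟪convect z a x, b x⟫_ℝ‖ := (Real.norm_eq_abs _).symm
    _ ≤ ∫ x, ‖⟪convect z a x, b x⟫_ℝ‖ := norm_integral_le_integral_norm _
    _ ≤ ∫ x, P x * ‖b x‖ :=
        integral_mono_of_nonneg (ae_of_all _ fun x => norm_nonneg _)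
          (hPc.mul hQc).integrable_unitAddTorus (ae_of_all _ hpt)
    _ ≤ Real.sqrt (∫ x, P x ^ 2) * Real.sqrt (∫ x, ‖b x‖ ^ 2) :=
        integral_mul_le_sqrt_mul_sqrt_of_continuous hPc hQc
          (fun x => mul_nonneg (norm_nonneg _) (norm_nonneg _)) fun x => norm_nonneg _

omit [DecidableEq d] in
/-- `∫ ‖z‖²‖Da‖² ≤ √(∫ ‖z‖⁴) √(∫ ‖Da‖⁴)` (Cauchy–Schwarz for the two squares). [folklore] -/
theorem integral_norm_mul_norm_fderiv_sq_le {z a : UnitAddTorus d → EuclideanSpace ℝ d}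
    (hz : IsSmooth z) (ha : IsSmooth a) :
    ∫ x, (‖z x‖ * ‖Torus.fderiv a x‖) ^ 2 ≤
      Real.sqrt (∫ x, ‖z x‖ ^ 4) * Real.sqrt (∫ x, ‖Torus.fderiv a x‖ ^ 4) := by
  have h := integral_mul_le_sqrt_mul_sqrt_of_continuous (f := fun x => ‖z x‖ ^ 2)
    (g := fun x => ‖Torus.fderiv a x‖ ^ 2) (hz.continuous.norm.pow 2)
    ((continuous_fderiv_of_isSmooth ha).norm.pow 2) (fun x => sq_nonneg _) fun x => sq_nonneg _
  have e1 : ∫ x, (‖z x‖ * ‖Torus.fderiv a x‖) ^ 2 = ∫ x, ‖z x‖ ^ 2 * ‖Torus.fderiv a x‖ ^ 2 :=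
    integral_congr_ae (ae_of_all _ fun x => by ring)
  have e4 : ∀ t : ℝ, (t ^ 2) ^ 2 = t ^ 4 := fun t => by ring
  simp only [e4] at h
  rw [e1]
  exact h

/-- **Transport term against the Laplacian, absorbed by the dissipation.** On `T^d` with
`card d = 3` there is `K ≥ 0` such that for every `ε > 0` and all smooth `u, w : T^d → ℝ^d` with
`∫ u = 0`,
`|∫ ⟪(u·∇)w, Δw⟫| ≤ ε ‖Δw‖₂² + K ε⁻⁷ (‖∇u‖₂²)⁴ ‖∇w‖₂²`.
Proof: `|∫ ⟪(u·∇)w, Δw⟫| ≤ √A ‖Δw‖₂` with `A = ∫ ‖u‖²‖Dw‖² ≤ ‖u‖²_{L⁴} ‖Dw‖²_{L⁴}`,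
`‖u‖⁴_{L⁴} ≤ K₄ (‖∇u‖₂²)²` (`integral_norm_pow_four_le_gradNormSq_sq`) and
`(‖Dw‖⁴_{L⁴})² ≤ K_D ‖∇w‖₂² (‖Δw‖₂²)³` (`integral_norm_fderiv_pow_four_sq_le`), so that
`A⁴ ≤ K₄²K_D (‖∇u‖₂²)⁴ ‖∇w‖₂² (‖Δw‖₂²)³`; two absorption steps (`le_mul_add_mul_of_pow_succ_le`
with `n = 3` and `n = 1`) — the `L⁴ × L⁴ × L²` Hölder/Ladyzhenskaya estimate of Constantin–Foias,
Prop. 6.1 (6.9) with `s₁ = s₂ = 3/4`, `s₃ = 0` (`|b(u, w, Aw)| ≤ c |u|^{1/4}‖u‖^{3/4} ‖w‖^{1/4}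
|Aw|^{3/4} |Aw|`), Poincaré–Wirtinger for the zero-mean `u`, and Young's inequality with exponents
`(8, 8/7)`, in polynomial form. [cite: ConstantinFoiasNSE1988, Ch. 6 Prop. 6.1 (6.9)] -/
theorem abs_integral_inner_convect_laplacian_transport_le (hd : Fintype.card d = 3) :
    ∃ K : ℝ, 0 ≤ K ∧ ∀ ε : ℝ, 0 < ε → ∀ u w : UnitAddTorus d → EuclideanSpace ℝ d,
      IsSmooth u → IsSmooth w → HasZeroMean u →
      |∫ x, ⟪convect u w x, laplacian w x⟫_ℝ| ≤
        ε * (∫ x, ‖laplacian w x‖ ^ 2) + K * (ε ^ 7)⁻¹ * gradNormSq u ^ 4 * gradNormSq w := by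
  obtain ⟨K₄, hK₄0, hK₄⟩ := integral_norm_pow_four_le_gradNormSq_sq (d := d) hd
  obtain ⟨K_D, hKD0, hKD⟩ := integral_norm_fderiv_pow_four_sq_le (d := d) hd
  refine ⟨128 * (K₄ ^ 2 * K_D), by positivity, fun ε hε u w hu hw hu0 => ?_⟩
  set T : ℝ := |∫ x, ⟪convect u w x, laplacian w x⟫_ℝ| with hT
  set Gu : ℝ := gradNormSq u with hGu
  set G : ℝ := gradNormSq w with hG
  set L : ℝ := ∫ x, ‖laplacian w x‖ ^ 2 with hL
  set A : ℝ := ∫ x, (‖u x‖ * ‖Torus.fderiv w x‖) ^ 2 with hA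
  have hT0 : 0 ≤ T := abs_nonneg _
  have hGu0 : 0 ≤ Gu := gradNormSq_nonneg u
  have hG0 : 0 ≤ G := gradNormSq_nonneg w
  have hL0 : 0 ≤ L := integral_nonneg fun x => sq_nonneg _
  have hA0 : 0 ≤ A := integral_nonneg fun x => sq_nonneg _
  have hX0 : 0 ≤ ∫ x, ‖u x‖ ^ 4 := integral_nonneg fun x => by positivity
  have hY0 : 0 ≤ ∫ x, ‖Torus.fderiv w x‖ ^ 4 := integral_nonneg fun x => by positivity
  -- Step 1: `T² ≤ A L`
  have h1 : T ≤ Real.sqrt A * Real.sqrt L :=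
    abs_integral_inner_convect_le_sqrt_mul_sqrt hu hw hw.laplacian
  have hT2 : T ^ (1 + 1) ≤ 1 * A * L ^ 1 := by
    calc T ^ (1 + 1) = T ^ 2 := by norm_num
      _ ≤ (Real.sqrt A * Real.sqrt L) ^ 2 := pow_le_pow_left₀ hT0 h1 2
      _ = 1 * A * L ^ 1 := by rw [mul_pow, Real.sq_sqrt hA0, Real.sq_sqrt hL0]; ring
  -- Step 2: `A⁴ ≤ K₄² K_D Gu⁴ G L³`
  have hA2 : A ^ 2 ≤ (∫ x, ‖u x‖ ^ 4) * ∫ x, ‖Torus.fderiv w x‖ ^ 4 := by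
    calc A ^ 2 ≤ (Real.sqrt (∫ x, ‖u x‖ ^ 4) * Real.sqrt (∫ x, ‖Torus.fderiv w x‖ ^ 4)) ^ 2 :=
          pow_le_pow_left₀ hA0 (integral_norm_mul_norm_fderiv_sq_le hu hw) 2
      _ = (∫ x, ‖u x‖ ^ 4) * ∫ x, ‖Torus.fderiv w x‖ ^ 4 := by
          rw [mul_pow, Real.sq_sqrt hX0, Real.sq_sqrt hY0]
  have hA4 : A ^ (3 + 1) ≤ (K₄ ^ 2 * K_D * Gu ^ 4) * G * L ^ 3 := by
    have hu4 : (∫ x, ‖u x‖ ^ 4) ^ 2 ≤ (K₄ * Gu ^ 2) ^ 2 := pow_le_pow_left₀ hX0 (hK₄ u hu hu0) 2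
    have hD4 : (∫ x, ‖Torus.fderiv w x‖ ^ 4) ^ 2 ≤ K_D * G * L ^ 3 := hKD w hw
    calc A ^ (3 + 1) = (A ^ 2) ^ 2 := by ring
      _ ≤ ((∫ x, ‖u x‖ ^ 4) * ∫ x, ‖Torus.fderiv w x‖ ^ 4) ^ 2 := pow_le_pow_left₀ (sq_nonneg _) hA2 2
      _ = (∫ x, ‖u x‖ ^ 4) ^ 2 * (∫ x, ‖Torus.fderiv w x‖ ^ 4) ^ 2 := mul_pow _ _ _
      _ ≤ (K₄ * Gu ^ 2) ^ 2 * (K_D * G * L ^ 3) :=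
          mul_le_mul hu4 hD4 (sq_nonneg _) (sq_nonneg _)
      _ = (K₄ ^ 2 * K_D * Gu ^ 4) * G * L ^ 3 := by ring
  -- Step 3: two absorptions, `δ = ε²/4`, `ε' = ε/2`
  have hδ : 0 < ε ^ 2 / 4 := by positivity
  have hε' : 0 < ε / 2 := by positivity
  have hAabs : A ≤ ε ^ 2 / 4 * L + (K₄ ^ 2 * K_D * Gu ^ 4) * ((ε ^ 2 / 4) ^ 3)⁻¹ * G :=
    le_mul_add_mul_of_pow_succ_le (by positivity) hG0 hL0 hδ hA4
  have hTabs : T ≤ ε / 2 * L + 1 * ((ε / 2) ^ 1)⁻¹ * A :=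
    le_mul_add_mul_of_pow_succ_le zero_le_one hA0 hL0 hε' hT2
  have hc1 : 1 * ((ε / 2) ^ 1)⁻¹ * (ε ^ 2 / 4) = ε / 2 := by
    field_simp
    ring
  have hc2 : 1 * ((ε / 2) ^ 1)⁻¹ * ((K₄ ^ 2 * K_D * Gu ^ 4) * ((ε ^ 2 / 4) ^ 3)⁻¹) =
      128 * (K₄ ^ 2 * K_D) * (ε ^ 7)⁻¹ * Gu ^ 4 := by
    field_simp
    ring
  have hi0 : 0 ≤ 1 * ((ε / 2) ^ 1)⁻¹ := by positivity
  calc T ≤ ε / 2 * L + 1 * ((ε / 2) ^ 1)⁻¹ * A := hTabs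
    _ ≤ ε / 2 * L + 1 * ((ε / 2) ^ 1)⁻¹ *
        (ε ^ 2 / 4 * L + (K₄ ^ 2 * K_D * Gu ^ 4) * ((ε ^ 2 / 4) ^ 3)⁻¹ * G) := by
        gcongr
    _ = ε / 2 * L + (1 * ((ε / 2) ^ 1)⁻¹ * (ε ^ 2 / 4)) * L +
        (1 * ((ε / 2) ^ 1)⁻¹ * ((K₄ ^ 2 * K_D * Gu ^ 4) * ((ε ^ 2 / 4) ^ 3)⁻¹)) * G := by ring
    _ = ε * L + 128 * (K₄ ^ 2 * K_D) * (ε ^ 7)⁻¹ * Gu ^ 4 * G := by rw [hc1, hc2]; ring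

/-- **Stretching term against the Laplacian, absorbed by the dissipation.** On `T^d` with
`card d = 3` there is `K ≥ 0` such that for every `ε > 0` and all smooth `w, v : T^d → ℝ^d` with
`∫ w = 0`,
`|∫ ⟪(w·∇)v, Δw⟫| ≤ ε ‖Δw‖₂² + K ε⁻¹ (‖∇v‖₂² + ‖Δv‖₂²) ‖∇w‖₂²`.
Proof: `|∫ ⟪(w·∇)v, Δw⟫| ≤ √B ‖Δw‖₂ ≤ ε‖Δw‖₂² + ε⁻¹ B` with
`B = ∫ ‖w‖²‖Dv‖² ≤ ‖w‖²_{L⁴} ‖Dv‖²_{L⁴}`, `‖w‖²_{L⁴} ≤ √K₄ ‖∇w‖₂²`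
(`integral_norm_pow_four_le_gradNormSq_sq`) and `‖Dv‖²_{L⁴} ≤ √K_D (‖∇v‖₂² + ‖Δv‖₂²)`
(`integral_norm_fderiv_pow_four_le_mul_add_sq`) — Constantin–Foias, Prop. 6.1 (6.9) with
`s₁ = s₂ = 3/4`, `s₃ = 0` (`|b(w, v, Aw)| ≤ c |w|^{1/4}‖w‖^{3/4} ‖v‖^{1/4}|Av|^{3/4} |Aw|`),
Poincaré–Wirtinger for the zero-mean `w`, and the bookkeeping
`‖v‖^{1/2}|Av|^{3/2} ≤ (‖v‖² + |Av|²)`-type bound `G^{1/2}L^{3/2} ≤ (G + L)²`. [cite: ConstantinFoiasNSE1988, Ch. 6 Prop. 6.1 (6.9)] -/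
theorem abs_integral_inner_convect_laplacian_stretching_le (hd : Fintype.card d = 3) :
    ∃ K : ℝ, 0 ≤ K ∧ ∀ ε : ℝ, 0 < ε → ∀ w v : UnitAddTorus d → EuclideanSpace ℝ d,
      IsSmooth w → IsSmooth v → HasZeroMean w →
      |∫ x, ⟪convect w v x, laplacian w x⟫_ℝ| ≤
        ε * (∫ x, ‖laplacian w x‖ ^ 2) +
          K * ε⁻¹ * (gradNormSq v + ∫ x, ‖laplacian v x‖ ^ 2) * gradNormSq w := by
  obtain ⟨K₄, hK₄0, hK₄⟩ := integral_norm_pow_four_le_gradNormSq_sq (d := d) hd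
  obtain ⟨K_D, hKD0, hKD⟩ := integral_norm_fderiv_pow_four_le_mul_add_sq (d := d) hd
  refine ⟨Real.sqrt K₄ * Real.sqrt K_D, by positivity, fun ε hε w v hw hv hw0 => ?_⟩
  set T : ℝ := |∫ x, ⟪convect w v x, laplacian w x⟫_ℝ| with hT
  set Gv : ℝ := gradNormSq v with hGv
  set Lv : ℝ := ∫ x, ‖laplacian v x‖ ^ 2 with hLv
  set G : ℝ := gradNormSq w with hG
  set L : ℝ := ∫ x, ‖laplacian w x‖ ^ 2 with hL
  set B : ℝ := ∫ x, (‖w x‖ * ‖Torus.fderiv v x‖) ^ 2 with hB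
  have hT0 : 0 ≤ T := abs_nonneg _
  have hGv0 : 0 ≤ Gv := gradNormSq_nonneg v
  have hLv0 : 0 ≤ Lv := integral_nonneg fun x => sq_nonneg _
  have hG0 : 0 ≤ G := gradNormSq_nonneg w
  have hL0 : 0 ≤ L := integral_nonneg fun x => sq_nonneg _
  have hB0 : 0 ≤ B := integral_nonneg fun x => sq_nonneg _
  -- Step 1: `T² ≤ B L`, hence `T ≤ ε L + ε⁻¹ B`
  have h1 : T ≤ Real.sqrt B * Real.sqrt L :=
    abs_integral_inner_convect_le_sqrt_mul_sqrt hw hv hw.laplacian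
  have hT2 : T ^ (1 + 1) ≤ 1 * B * L ^ 1 := by
    calc T ^ (1 + 1) = T ^ 2 := by norm_num
      _ ≤ (Real.sqrt B * Real.sqrt L) ^ 2 := pow_le_pow_left₀ hT0 h1 2
      _ = 1 * B * L ^ 1 := by rw [mul_pow, Real.sq_sqrt hB0, Real.sq_sqrt hL0]; ring
  have hTabs : T ≤ ε * L + 1 * (ε ^ 1)⁻¹ * B :=
    le_mul_add_mul_of_pow_succ_le zero_le_one hB0 hL0 hε hT2
  -- Step 2: `B ≤ √K₄ G · √K_D (Gv + Lv)`
  have hw4 : Real.sqrt (∫ x, ‖w x‖ ^ 4) ≤ Real.sqrt K₄ * G := by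
    calc Real.sqrt (∫ x, ‖w x‖ ^ 4) ≤ Real.sqrt (K₄ * G ^ 2) := Real.sqrt_le_sqrt (hK₄ w hw hw0)
      _ = Real.sqrt K₄ * G := by rw [Real.sqrt_mul hK₄0, Real.sqrt_sq hG0]
  have hv4 : Real.sqrt (∫ x, ‖Torus.fderiv v x‖ ^ 4) ≤ Real.sqrt K_D * (Gv + Lv) := by
    calc Real.sqrt (∫ x, ‖Torus.fderiv v x‖ ^ 4) ≤ Real.sqrt (K_D * (Gv + Lv) ^ 2) :=
          Real.sqrt_le_sqrt (hKD v hv)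
      _ = Real.sqrt K_D * (Gv + Lv) := by
          rw [Real.sqrt_mul hKD0, Real.sqrt_sq (add_nonneg hGv0 hLv0)]
  have hBle : B ≤ (Real.sqrt K₄ * G) * (Real.sqrt K_D * (Gv + Lv)) :=
    (integral_norm_mul_norm_fderiv_sq_le hw hv).trans
      (mul_le_mul hw4 hv4 (Real.sqrt_nonneg _) (by positivity))
  have hi0 : 0 ≤ 1 * (ε ^ 1)⁻¹ := by positivity
  calc T ≤ ε * L + 1 * (ε ^ 1)⁻¹ * B := hTabs
    _ ≤ ε * L + 1 * (ε ^ 1)⁻¹ * ((Real.sqrt K₄ * G) * (Real.sqrt K_D * (Gv + Lv))) := by gcongr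
    _ = ε * L + Real.sqrt K₄ * Real.sqrt K_D * ε⁻¹ * (Gv + Lv) * G := by ring

end Torus

end Literature.Analysis.FunctionSpaces

end
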